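import Literature.Analysis.FluidPDE.ElgindiWkInftyNorm
import Literature.Analysis.FluidPDE.ElgindiStripCalculusTwo
import Literature.Analysis.FluidPDE.ElgindiAveragingOperators
import HarnessLib

/-!
# The damped angular derivative `A_γ` of the `𝓦^{l,∞}` norm: `D_θ = (γ − 1 + sin 2θ)·A_γ` and commutation with `∂_z`
([ElgindiGhoulMasmoudi2021] §1.7, §9 Proposition 9.3: "whenever derivatives fall onto `g` we can take them out of the integral")

Topic `Literature/Analysis/FluidPDE`. Support file (definitions with bodies and proved theorems, no
named facts) on the proof path of the named fact
`Literature.Analysis.FluidPDE.Elgindi.ElgindiGhoulMasmoudi2021_stabilityCore`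
(`ElgindiStabilityDecomposition.lean`). T. M. Elgindi, T.-E. Ghoul, N. Masmoudi, Camb. J. Math. 9
(2021) = arXiv:1910.14071, §1.7 (p. 6) and §9 Proposition 9.3 (p. 20).

The identities that convert the words `D_θ^i D_z^j` of the `𝓗ᵏ` norm into the terms of the
`𝓦^{l,∞}` norm: `D_θ f = (γ − 1 + sin 2θ)·A_γ f` (so a `D_θ` falling on the `𝓦`-factor produces the
small factor `γ − 1 + sin 2θ`), `A_γ` is `ℝ`-linear, commutes with radial multipliers and with `∂_z`
on the open strip, and preserves smoothness there.
-/

noncomputable section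

open MeasureTheory Set Function Real Filter
open _root_.Topology
open scoped ENNReal ContDiff

namespace Literature.Analysis.FluidPDE

namespace Elgindi

/-- The damping coefficient `sin 2θ/(γ − 1 + sin 2θ)` of `A_γ`. [folklore] -/
def angCoefW (α θ : ℝ) : ℝ := Real.sin (2 * θ) / (gammaExp α - 1 + Real.sin (2 * θ))

/-- `A_γ f = angCoefW·∂_θ f`. [folklore] -/
theorem angOpW_eq (α : ℝ) (f : ℝ → ℝ → ℝ) (z θ : ℝ) : angOpW α f z θ = angCoefW α θ * dθ f z θ := rfl

/-- `γ − 1 + sin 2θ > 0` on `(0, π/2)` (indeed for `sin 2θ > −(γ−1)`), `γ = 1 + α/10`, `α > 0`. [folklore] -/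
theorem gammaExp_sub_one_add_sin_pos {α : ℝ} (hα : 0 < α) {θ : ℝ} (hθ : θ ∈ Ioo 0 (π / 2)) :
    0 < gammaExp α - 1 + Real.sin (2 * θ) := by
  have hs : 0 < Real.sin (2 * θ) := Real.sin_pos_of_pos_of_lt_pi (by linarith [hθ.1]) (by linarith [hθ.2])
  unfold gammaExp; linarith

/-- `0 ≤ angCoefW ≤ 1` on `(0, π/2)`. [folklore] -/
theorem angCoefW_mem_Icc {α : ℝ} (hα : 0 < α) {θ : ℝ} (hθ : θ ∈ Ioo 0 (π / 2)) : angCoefW α θ ∈ Icc (0:ℝ) 1 := by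
  have hs : 0 < Real.sin (2 * θ) := Real.sin_pos_of_pos_of_lt_pi (by linarith [hθ.1]) (by linarith [hθ.2])
  have hd := gammaExp_sub_one_add_sin_pos hα hθ
  unfold angCoefW
  refine ⟨div_nonneg hs.le hd.le, ?_⟩
  rw [div_le_one hd]
  unfold gammaExp; linarith

/-- `angCoefW ≤ sin 2θ/(γ − 1)`: the coefficient is `O(sin 2θ/α)` near the boundary. [folklore] -/
theorem angCoefW_le_sin_div {α : ℝ} (hα : 0 < α) {θ : ℝ} (hθ : θ ∈ Ioo 0 (π / 2)) :
    angCoefW α θ ≤ Real.sin (2 * θ) / (gammaExp α - 1) := by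
  have hs : 0 < Real.sin (2 * θ) := Real.sin_pos_of_pos_of_lt_pi (by linarith [hθ.1]) (by linarith [hθ.2])
  have hg : 0 < gammaExp α - 1 := by unfold gammaExp; linarith
  unfold angCoefW
  exact div_le_div_of_nonneg_left hs.le hg (by linarith)

/-- **`D_θ f = (γ − 1 + sin 2θ)·A_γ f`** on `(0, π/2)` (any `z`). [cite: ElgindiGhoulMasmoudi2021, §1.7 (p. 6 of arXiv:1910.14071)] -/
theorem Dθ_eq_mul_angOpW {α : ℝ} (hα : 0 < α) (f : ℝ → ℝ → ℝ) (z : ℝ) {θ : ℝ} (hθ : θ ∈ Ioo 0 (π / 2)) :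
    Dθ f z θ = (gammaExp α - 1 + Real.sin (2 * θ)) * angOpW α f z θ := by
  have hd := (gammaExp_sub_one_add_sin_pos hα hθ).ne'
  rw [Dθ_eq_mul_dθ, angOpW_eq, angCoefW]
  field_simp

/-- `A_γ` is `ℝ`-linear: constants. [folklore] -/
theorem angOpW_const_mul (α c : ℝ) (f : ℝ → ℝ → ℝ) (z θ : ℝ) : angOpW α (fun z θ => c * f z θ) z θ = c * angOpW α f z θ := by
  rw [angOpW_eq, angOpW_eq, dθ_const_mul']; ring

/-- `A_γ` commutes with radial multipliers (no differentiability needed). [folklore] -/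
theorem angOpW_radialMul (α : ℝ) (c : ℝ → ℝ) (f : ℝ → ℝ → ℝ) (z θ : ℝ) :
    angOpW α (radialMul c f) z θ = c z * angOpW α f z θ := by
  rw [angOpW_eq, angOpW_eq, dθ_radialMul]; ring

/-- `A_γ` preserves smoothness on the open strip (`α > 0`). [folklore] -/
theorem contDiffOn_angOpW_strip {α : ℝ} (hα : 0 < α) {f : ℝ → ℝ → ℝ} (hf : ContDiffOn ℝ ∞ (uncurry f) strip) :
    ContDiffOn ℝ ∞ (uncurry (angOpW α f)) strip := by
  have hc : ContDiffOn ℝ ∞ (fun p : ℝ × ℝ => angCoefW α p.2) strip := by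
    unfold angCoefW
    exact ContDiffOn.div (by fun_prop) (by fun_prop) fun p hp => (gammaExp_sub_one_add_sin_pos hα hp.2).ne'
  have e : uncurry (angOpW α f) = fun p : ℝ × ℝ => angCoefW α p.2 * uncurry (dθ f) p := by
    funext p; rfl
  rw [e]
  exact hc.mul (contDiffOn_dθ_strip hf)

/-- Iterates of `A_γ` preserve smoothness on the open strip. [folklore] -/
theorem contDiffOn_iterate_angOpW_strip {α : ℝ} (hα : 0 < α) {f : ℝ → ℝ → ℝ} (hf : ContDiffOn ℝ ∞ (uncurry f) strip) (j : ℕ) :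
    ContDiffOn ℝ ∞ (uncurry ((angOpW α)^[j] f)) strip := by
  induction j with
  | zero => exact hf
  | succ j ih => rw [Function.iterate_succ_apply']; exact contDiffOn_angOpW_strip hα ih

/-- `∂_z` passes through angular coefficients: `∂_z(c(θ)g) = c(θ)∂_z g`. [folklore] -/
theorem dz_angular_mul (c : ℝ → ℝ) (g : ℝ → ℝ → ℝ) (z θ : ℝ) : dz (fun z θ => c θ * g z θ) z θ = c θ * dz g z θ := by
  show deriv (fun z' => c θ * g z' θ) z = c θ * deriv (fun z' => g z' θ) z
  exact deriv_const_mul_field _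

/-- **`∂_z` commutes with `A_γ` on the open strip** (equality of mixed partials for `f ∈ C²(strip)`). [folklore] -/
theorem dz_angOpW_strip (α : ℝ) {f : ℝ → ℝ → ℝ} (hf : ContDiffOn ℝ 2 (uncurry f) strip) {p : ℝ × ℝ} (hp : p ∈ strip) :
    dz (angOpW α f) p.1 p.2 = angOpW α (dz f) p.1 p.2 := by
  have e : angOpW α f = fun z θ => angCoefW α θ * dθ f z θ := rfl
  rw [e, dz_angular_mul, angOpW_eq, ← dθ_dz_eq_dz_dθ hf hp]

/-- `∂_z` preserves smoothness on the strip (re-export for the iterates below). [folklore] -/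
theorem contDiffOn_iterate_dz_strip {f : ℝ → ℝ → ℝ} (hf : ContDiffOn ℝ ∞ (uncurry f) strip) (k : ℕ) :
    ContDiffOn ℝ ∞ (uncurry (dz^[k] f)) strip := by
  induction k with
  | zero => exact hf
  | succ k ih => rw [Function.iterate_succ_apply']; exact contDiffOn_dz_strip ih

/-- **`∂_z^k` commutes with `A_γ^j` on the open strip** for `f` smooth there. [cite: ElgindiGhoulMasmoudi2021, §9 Proposition 9.3 (p. 20 of arXiv:1910.14071)] -/
theorem iterate_dz_iterate_angOpW_strip {α : ℝ} (hα : 0 < α) {f : ℝ → ℝ → ℝ} (hf : ContDiffOn ℝ ∞ (uncurry f) strip) (k j : ℕ) :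
    ∀ p ∈ strip, (dz^[k] ((angOpW α)^[j] f)) p.1 p.2 = ((angOpW α)^[j] (dz^[k] f)) p.1 p.2 := by
  -- first one `∂_z` through `A_γ^j`, as functions agreeing on the strip
  have h1 : ∀ (g : ℝ → ℝ → ℝ), ContDiffOn ℝ ∞ (uncurry g) strip → ∀ j : ℕ, ∀ p ∈ strip,
      dz ((angOpW α)^[j] g) p.1 p.2 = ((angOpW α)^[j] (dz g)) p.1 p.2 := by
    intro g hg j
    induction j generalizing g with
    | zero => intro p _; rfl
    | succ j ih =>
      intro p hp
      have hgj : ContDiffOn ℝ ∞ (uncurry ((angOpW α)^[j] g)) strip := contDiffOn_iterate_angOpW_strip hα hg j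
      rw [Function.iterate_succ_apply', Function.iterate_succ_apply',
        dz_angOpW_strip α (hgj.of_le (WithTop.coe_le_coe.2 le_top : (2 : WithTop ℕ∞) ≤ ((⊤ : ℕ∞) : WithTop ℕ∞))) hp]
      -- `A_γ (∂_z A^j g) = A_γ (A^j ∂_z g)` at `p`: the two inner functions agree on the strip
      rw [angOpW_eq, angOpW_eq, dθ_congr (fun q hq => ih g hg q hq) hp]
  intro p hp
  induction k generalizing p with
  | zero => rfl
  | succ k ih =>
    rw [Function.iterate_succ_apply', Function.iterate_succ_apply']
    -- `∂_z (∂_z^k A^j f) = ∂_z (A^j ∂_z^k f)` at `p` (agree on the strip), then pass `∂_z` through `A^j`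
    have hcongr : dz (dz^[k] ((angOpW α)^[j] f)) p.1 p.2 = dz ((angOpW α)^[j] (dz^[k] f)) p.1 p.2 :=
      dz_congr (fun q hq => ih q hq) hp
    rw [hcongr, h1 _ (contDiffOn_iterate_dz_strip hf k) j p hp]

end Elgindi

end Literature.Analysis.FluidPDE
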